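import Summits.QuantumFields.YangMills.Theorems.UnitScaleTiltProp7PinnedFlatComponent
import HarnessLib

/-!
# N7 (part 2 of 2) — THE LINEAR FLAT CORE OF STUB (P), ASSEMBLED:
# `Σ_b ‖Y(b)‖²_F ≤ C(L,N)·(L^k)²·Σ_p ‖(∂Y)(p)‖²_F` for `Q^{(k)}Y = 0` and `∂^*Y` supported on the `k`-centres
(route R of crux K1 «MinimiserStabilityRegPr», stmt-QuantumFields-19200; CARD-19200-V3-g11 §5 Steps 2, 3, 6; ym3-torus seat ym-ust-20520-w3 g2,
`--supports stmt-QuantumFields-19200 --as helper`)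

YM₃ on T³ is a RUNG of the ladder (R3), not the Clay problem.

WHAT IS PROVED (sorry-free, no definition; `d = 3`, lattice factor `1`, `M_N(ℂ)`-valued bond fields, Frobenius sums `Σ_{a,b}|·_{ab}|²`,
`Q^{(k)}` an ABSTRACT composite of `linAvg` (`hQ0`, `hQs`) as in N6∕N7-A):
* `component_bound` — part 1's `sum_sq_add_grad_sq_le_of_component` read through an `ℝ`-linear entry reading `π` of the matrix Hodge parts.
* ★★ `sum_normSq_le_curl_normSq_of_pinned (hd : P.d = 3) (Q) (hQ0) (hQs) (Y) (hk : k ≤ m + K) (hQY : Q^{(k)}Y = 0)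
  (hpin : ∂^*Y = 0 off Set.range (embIter k))` :
  `Σ_b Σ_{a,b′} |Y(b)_{ab′}|² ≤ (4200·N²·L⁴/(√L − 1)² + 97/8)·(L^k)²·Σ_p Σ_{a,b′} |(∂Y)(p)_{ab′}|²` — constants independent of `k` and of the volume;
  `sum_normSq_le_curl_normSq_of_pinned'` the same with the CARD's pointwise pinning hypothesis `(∀ y, x ≠ embIter k y) → ∂^*Y(x) = 0`.
* `sum_normSq_le_curl_normSq_of_pinned_T3` — the instance on run `K` of a T³ family over the comparison height `n` (`k = K − n`).

PROOF (CARD §5): Step 2 `Prop7MatrixHodgeSplit.exists_matrixHodgeSplit_pinned` (`Y = B + ∂φ`, `∂^*B = 0`, Frobenius energy identity, entrywise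
Dirichlet principle); Step 3 `Prop7PinnedConstraintSplit.exists_constraint_on_hodge_parts_bound` (`L^k·Q_kB(c) + (φ(y′₀) − φ(y₀)) = Λ(y′) − Λ(y)`,
`‖Λ(y)‖² ≤ c₂·E_k(B)(y)`, `c₂ = (5L)²·N·L²·L^k/(√L−1)²`); Steps 4–5 = part 1 per real component `re∕im (· a b′)`; Step 6: sum over the `2N²` components,
`Σ_c ‖Λ(c₊) − Λ(c₋)‖²_F ≤ 2N·c₂·Σ_c (E(c₊) + E(c₋)) = 12N·c₂·Σ_y E(y) ≤ 12N·c₂·Σ_p‖∂B‖²_F = 12N·c₂·Σ_p‖∂Y‖²_F`.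
-/

set_option autoImplicit false

noncomputable section

open scoped BigOperators Matrix.Norms.L2Operator Matrix

namespace Summit.QuantumFields.YangMills.Theorems.Prop7PinnedFlatCoercivity

open Literature.MathematicalPhysics.QuantumFieldTheory.Balaban1983to89
open Finset LatticeFieldCalculus BlockAveragingEMLLinearised
open B15DeterminingSets (embIter)
open B10StarCount (sum_pbond)

variable {P : Params} {N : ℕ}

/-- three finite sums commute cyclically. [folklore] -/
theorem sum_comm₃ {α β γ : Type*} [Fintype α] [Fintype β] [Fintype γ] (f : α → β → γ → ℝ) :
    ∑ x, ∑ y, ∑ z, f x y z = ∑ y, ∑ z, ∑ x, f x y z := by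
  rw [Finset.sum_comm]
  exact Finset.sum_congr rfl fun y _ => by rw [Finset.sum_comm]

/-- **ONE READING OF THE MATRIX HODGE PARTS** (Steps 4–5 through `π`): for `B = Y − ∂φ` with `∂^*B = 0`, the matrix constraint of N7-A and the Dirichlet
principle for `π ∘ φ`, part 1's component bound reads
`Σ_b π(B(b))² + Σ_b (∂(π∘φ))(b)² ≤ 14L^k·Σ_c π(Λ(c₊) − Λ(c₋))² + (97/8)(L^k)²·Σ_p π((∂Y)(p))²` (`∂B = ∂Y`).
[cite: Balaban1984PropagatorsI, Prop. 1.1 (1.90) p.33; Balaban1985Variational, Prop. 7 p.299] -/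
theorem component_bound (hd : P.d = 3) {k : ℕ} (hk : k ≤ P.m + P.K) (π : Matrix (Fin N) (Fin N) ℂ →ₗ[ℝ] ℝ)
    (Y : PBond P 0 → Matrix (Fin N) (Fin N) ℂ) (φ : Site P 0 → Matrix (Fin N) (Fin N) ℂ) (Λ : Site P k → Matrix (Fin N) (Fin N) ℂ)
    (hcoul : diverg 1 (fun e => Y e - grad 1 φ e) = 0)
    (hC1 : ∀ c : PBond P k, (P.L ^ k : ℕ) • bondAvgIter k (fun e => Y e - grad 1 φ e) c + (φ (embIter k c.tgt) - φ (embIter k c.src))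
      = Λ c.tgt - Λ c.src)
    (hmin : ∀ ψ : SiteField P 0 ℝ, (∀ x ∈ Set.range (embIter k), ψ x = π (φ x)) →
      ∑ b : PBond P 0, grad 1 (fun x => π (φ x)) b ^ 2 ≤ ∑ b : PBond P 0, grad 1 ψ b ^ 2) :
    ∑ b : PBond P 0, π (Y b - grad 1 φ b) ^ 2 + ∑ b : PBond P 0, grad 1 (fun x => π (φ x)) b ^ 2
      ≤ 14 * (P.L : ℝ) ^ k * ∑ c : PBond P k, π (Λ c.tgt - Λ c.src) ^ 2
        + (97 / 8) * ((P.L : ℝ) ^ k) ^ 2 * ∑ p : Plaq P 0, π (curl 1 Y p) ^ 2 := by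
  have hdiv : diverg 1 (fun e => π (Y e - grad 1 φ e)) = 0 := by
    funext x
    rw [Pi.zero_apply, ← map_diverg π _ x, congrFun hcoul x, Pi.zero_apply, map_zero]
  have hC1' : ∀ c : PBond P k, (P.L : ℝ) ^ k * bondAvgIter k (fun e => π (Y e - grad 1 φ e)) c
      + (π (φ (embIter k c.tgt)) - π (φ (embIter k c.src))) = π (Λ c.tgt - Λ c.src) := by
    intro c
    have hc := congrArg π (hC1 c)
    rw [map_add, map_nsmul, map_bondAvgIter π hk, map_sub, nsmul_eq_mul] at hc
    push_cast at hc
    exact hc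
  have hmain := sum_sq_add_grad_sq_le_of_component hd hk (fun e => π (Y e - grad 1 φ e)) (fun x => π (φ x))
    (fun c => π (Λ c.tgt - Λ c.src)) hdiv hC1' hmin
  have hcurl : ∀ p : Plaq P 0, curl 1 (fun e => π (Y e - grad 1 φ e)) p = π (curl 1 Y p) := fun p => by
    rw [← map_curl π _ p]
    exact congrArg π (curl_gaugeShift 1 1 φ Y p)
  simp only [hcurl] at hmain
  exact hmain

/-- ★★ **P-LIN-FLAT, PINNED** (CARD-19200-V3-g11 §2∕§5; `d = 3`): for an `M_N(ℂ)`-valued bond field `Y` on the finest torus with `Q^{(k)}Y = 0`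
(`Q^{(k)}` any composite of the linearised average) and `∂^*Y` supported on the `k`-centres `embIter k y`,
`Σ_b ‖Y(b)‖²_F ≤ (4200·N²·L⁴/(√L − 1)² + 97/8)·(L^k)²·Σ_p ‖(∂Y)(p)‖²_F` — uniformly in `k` and in the volume.
[cite: Balaban1984PropagatorsI, Prop. 1.1 (1.90) p.33; Balaban1985Variational, Prop. 7 p.299, (141)-(143) p.299] -/
theorem sum_normSq_le_curl_normSq_of_pinned (hd : P.d = 3) [NeZero N]
    (Q : (i : ℕ) → (PBond P 0 → Matrix (Fin N) (Fin N) ℂ) → PBond P i → Matrix (Fin N) (Fin N) ℂ)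
    (hQ0 : ∀ Y, Q 0 Y = Y)
    (hQs : ∀ (i : ℕ) (Y : PBond P 0 → Matrix (Fin N) (Fin N) ℂ) (c : PBond P (i + 1)), Q (i + 1) Y c = linAvg (Q i Y) c)
    (Y : PBond P 0 → Matrix (Fin N) (Fin N) ℂ) {k : ℕ} (hk : k ≤ P.m + P.K) (hQY : ∀ c : PBond P k, Q k Y c = 0)
    (hpin : ∀ x : Site P 0, x ∉ Set.range (embIter k) → diverg 1 Y x = 0) :
    ∑ b : PBond P 0, ∑ a : Fin N, ∑ b' : Fin N, Complex.normSq ((Y b) a b')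
      ≤ (4200 * (N : ℝ) ^ 2 * (P.L : ℝ) ^ 4 / (Real.sqrt P.L - 1) ^ 2 + 97 / 8) * ((P.L : ℝ) ^ k) ^ 2
          * ∑ p : Plaq P 0, ∑ a : Fin N, ∑ b' : Fin N, Complex.normSq ((curl 1 Y p) a b') := by
  classical
  -- Step 2: the matrix Hodge split
  obtain ⟨φ, hcoul, -, hEid, hDirR, hDirI⟩ := Prop7MatrixHodgeSplit.exists_matrixHodgeSplit_pinned Y hpin
  have hYB : ∀ b : PBond P 0, Y b = (fun e => Y e - grad 1 φ e) b + (φ b.tgt - φ b.src) := fun b => by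
    simp only [grad, one_smul, sub_add_cancel]
  -- Step 3: the constraint on the Hodge parts, with the `(H¹)^*`-bounded `Λ`
  obtain ⟨Λ, hC1, hC2⟩ := Prop7PinnedConstraintSplit.exists_constraint_on_hodge_parts_bound hd Q hQ0 hQs Y
    (fun e => Y e - grad 1 φ e) φ hYB hk hQY
  -- letters
  have hL1 : (1 : ℝ) < P.L := by exact_mod_cast P.hL.2
  set ℓ : ℝ := (P.L : ℝ) ^ k with hℓ
  have hℓ0 : 0 < ℓ := by positivity
  set CURL : ℝ := ∑ p : Plaq P 0, ∑ a : Fin N, ∑ b' : Fin N, Complex.normSq ((curl 1 Y p) a b') with hCURL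
  set R : ℝ := ∑ c : PBond P k, ∑ a : Fin N, ∑ b' : Fin N, Complex.normSq ((Λ c.tgt - Λ c.src) a b') with hR
  set c₂ : ℝ := (((P.d + 2) * P.L : ℕ) : ℝ) ^ 2 * N * (P.L : ℝ) ^ 2 * ((P.L : ℝ) ^ k / (Real.sqrt P.L - 1) ^ 2) with hc₂
  have hc₂0 : 0 ≤ c₂ := by positivity
  -- Steps 4–5 per entry, summed (Step 6a)
  have hent : ∀ a b' : Fin N,
      (∑ e : PBond P 0, Complex.normSq ((Y e - grad 1 φ e) a b') + ∑ e : PBond P 0, Complex.normSq ((grad 1 φ e) a b'))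
        ≤ 14 * ℓ * ∑ c : PBond P k, Complex.normSq ((Λ c.tgt - Λ c.src) a b')
          + (97 / 8) * ℓ ^ 2 * ∑ p : Plaq P 0, Complex.normSq ((curl 1 Y p) a b') := by
    intro a b'
    obtain ⟨πr, hπr⟩ := exists_reEntry (N := N) a b'
    obtain ⟨πi, hπi⟩ := exists_imEntry (N := N) a b'
    have hminR : ∀ ψ : SiteField P 0 ℝ, (∀ x ∈ Set.range (embIter k), ψ x = πr (φ x)) →
        ∑ b : PBond P 0, grad 1 (fun x => πr (φ x)) b ^ 2 ≤ ∑ b : PBond P 0, grad 1 ψ b ^ 2 := by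
      simp only [hπr]
      simpa only [Prop7MatrixHodgeSplit.re_grad_apply] using hDirR a b'
    have hminI : ∀ ψ : SiteField P 0 ℝ, (∀ x ∈ Set.range (embIter k), ψ x = πi (φ x)) →
        ∑ b : PBond P 0, grad 1 (fun x => πi (φ x)) b ^ 2 ≤ ∑ b : PBond P 0, grad 1 ψ b ^ 2 := by
      simp only [hπi]
      simpa only [Prop7MatrixHodgeSplit.im_grad_apply] using hDirI a b'
    have hr := component_bound hd hk πr Y φ Λ hcoul hC1 hminR
    have hi := component_bound hd hk πi Y φ Λ hcoul hC1 hminI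
    simp only [hπr] at hr
    simp only [hπi] at hi
    simp only [← Prop7MatrixHodgeSplit.re_grad_apply] at hr
    simp only [← Prop7MatrixHodgeSplit.im_grad_apply] at hi
    simp only [Prop7MatrixHodgeSplit.normSq_eq_re_sq_add_im_sq, Finset.sum_add_distrib, mul_add]
    linarith [hr, hi]
  have hsum : ∑ b : PBond P 0, ∑ a : Fin N, ∑ b' : Fin N, Complex.normSq ((Y b) a b') ≤ 14 * ℓ * R + (97 / 8) * ℓ ^ 2 * CURL := by
    rw [hEid, sum_comm₃ (fun (e : PBond P 0) (a b' : Fin N) => Complex.normSq ((Y e - grad 1 φ e) a b')),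
      sum_comm₃ (fun (e : PBond P 0) (a b' : Fin N) => Complex.normSq ((grad 1 φ e) a b')), hR, hCURL,
      sum_comm₃ (fun (c : PBond P k) (a b' : Fin N) => Complex.normSq ((Λ c.tgt - Λ c.src) a b')),
      sum_comm₃ (fun (p : Plaq P 0) (a b' : Fin N) => Complex.normSq ((curl 1 Y p) a b')),
      Finset.mul_sum, Finset.mul_sum, ← Finset.sum_add_distrib, ← Finset.sum_add_distrib]
    refine Finset.sum_le_sum fun a _ => ?_
    rw [Finset.mul_sum, Finset.mul_sum, ← Finset.sum_add_distrib, ← Finset.sum_add_distrib]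
    exact Finset.sum_le_sum fun b' _ => hent a b'
  -- Step 6b: `R ≤ 12·N·c₂·CURL`
  have hcurlB : ∀ p : Plaq P 0, curl 1 (fun e => Y e - grad 1 φ e) p = curl 1 Y p := fun p => curl_gaugeShift 1 1 φ Y p
  have hRle : R ≤ 12 * N * c₂ * CURL := by
    set Eb : Site P k → ℝ := fun y => ∑ μ : Fin P.d, ∑ ν : Fin P.d, ∑ x ∈ univ.filter (fun x : Site P 0 => Site.proj k k x = y),
        (if Site.proj k k (x.shift ν) = y then
          ‖(Y ⟨x.shift ν, μ⟩ - grad 1 φ ⟨x.shift ν, μ⟩) - (Y ⟨x, μ⟩ - grad 1 φ ⟨x, μ⟩)‖ ^ 2 else 0) with hEb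
    have hC2' : ∀ y : Site P k, ‖Λ y‖ ^ 2 ≤ c₂ * Eb y := fun y => by simpa only [hEb] using hC2 y
    -- Frobenius of a difference, Frobenius ≤ N·op², N6's bound
    have h1 : ∀ c : PBond P k, ∑ a : Fin N, ∑ b' : Fin N, Complex.normSq ((Λ c.tgt - Λ c.src) a b')
        ≤ 2 * N * c₂ * (Eb c.tgt + Eb c.src) := by
      intro c
      have ht := (sum_normSq_le_mul_opNorm_sq (Λ c.tgt)).trans (mul_le_mul_of_nonneg_left (hC2' c.tgt) (Nat.cast_nonneg N))
      have hs := (sum_normSq_le_mul_opNorm_sq (Λ c.src)).trans (mul_le_mul_of_nonneg_left (hC2' c.src) (Nat.cast_nonneg N))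
      have hsub := sum_normSq_sub_le (Λ c.tgt) (Λ c.src)
      have e1 : (↑N * (c₂ * Eb c.tgt) : ℝ) = N * c₂ * Eb c.tgt := by ring
      have e2 : (↑N * (c₂ * Eb c.src) : ℝ) = N * c₂ * Eb c.src := by ring
      linarith [ht, hs, hsub]
    have h2 := Finset.sum_le_sum fun c (_ : c ∈ (Finset.univ : Finset (PBond P k))) => h1 c
    rw [← Finset.mul_sum, sum_pbond_tgt_add_src Eb, ← hR] at h2
    -- the block energies against the Frobenius curl energy
    have h3 := sum_blockEnergy_le (P := P) (k := k) (fun e => Y e - grad 1 φ e)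
    rw [sum_grad_normSq_eq_curl_normSq _ hcoul] at h3
    simp only [hcurlB] at h3
    have h3' : ∑ y : Site P k, Eb y ≤ CURL := by simpa only [hEb, hCURL] using h3
    have hd3 : (P.d : ℝ) = 3 := by exact_mod_cast hd
    rw [hd3] at h2
    have h4 := mul_le_mul_of_nonneg_left h3' (by positivity : (0 : ℝ) ≤ 2 * N * c₂ * (2 * 3))
    linarith [h2, h4]
  -- Step 6c: the constant
  have h5L : (((P.d + 2) * P.L : ℕ) : ℝ) = 5 * P.L := by rw [hd]; push_cast; ring
  have hCURL0 : 0 ≤ CURL := Finset.sum_nonneg fun _ _ => Finset.sum_nonneg fun _ _ => Finset.sum_nonneg fun _ _ => Complex.normSq_nonneg _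
  have hfin : 14 * ℓ * R ≤ 4200 * (N : ℝ) ^ 2 * (P.L : ℝ) ^ 4 / (Real.sqrt P.L - 1) ^ 2 * ℓ ^ 2 * CURL := by
    have h := mul_le_mul_of_nonneg_left hRle (by positivity : (0 : ℝ) ≤ 14 * ℓ)
    refine h.trans (le_of_eq ?_)
    rw [hc₂, h5L]
    ring
  calc ∑ b : PBond P 0, ∑ a : Fin N, ∑ b' : Fin N, Complex.normSq ((Y b) a b')
      ≤ 14 * ℓ * R + (97 / 8) * ℓ ^ 2 * CURL := hsum
    _ ≤ 4200 * (N : ℝ) ^ 2 * (P.L : ℝ) ^ 4 / (Real.sqrt P.L - 1) ^ 2 * ℓ ^ 2 * CURL + (97 / 8) * ℓ ^ 2 * CURL := by linarith [hfin]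
    _ = (4200 * (N : ℝ) ^ 2 * (P.L : ℝ) ^ 4 / (Real.sqrt P.L - 1) ^ 2 + 97 / 8) * ℓ ^ 2 * CURL := by ring

/-- The same with the CARD's pointwise pinning hypothesis `(∀ y, x ≠ embIter k y) → ∂^*Y(x) = 0`.
[cite: Balaban1984PropagatorsI, Prop. 1.1 (1.90) p.33; Balaban1985Variational, Prop. 7 p.299] -/
theorem sum_normSq_le_curl_normSq_of_pinned' (hd : P.d = 3) [NeZero N]
    (Q : (i : ℕ) → (PBond P 0 → Matrix (Fin N) (Fin N) ℂ) → PBond P i → Matrix (Fin N) (Fin N) ℂ)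
    (hQ0 : ∀ Y, Q 0 Y = Y)
    (hQs : ∀ (i : ℕ) (Y : PBond P 0 → Matrix (Fin N) (Fin N) ℂ) (c : PBond P (i + 1)), Q (i + 1) Y c = linAvg (Q i Y) c)
    (Y : PBond P 0 → Matrix (Fin N) (Fin N) ℂ) {k : ℕ} (hk : k ≤ P.m + P.K) (hQY : ∀ c : PBond P k, Q k Y c = 0)
    (hpin : ∀ x : Site P 0, (∀ y : Site P k, x ≠ embIter k y) → diverg 1 Y x = 0) :
    ∑ b : PBond P 0, ∑ a : Fin N, ∑ b' : Fin N, Complex.normSq ((Y b) a b')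
      ≤ (4200 * (N : ℝ) ^ 2 * (P.L : ℝ) ^ 4 / (Real.sqrt P.L - 1) ^ 2 + 97 / 8) * ((P.L : ℝ) ^ k) ^ 2
          * ∑ p : Plaq P 0, ∑ a : Fin N, ∑ b' : Fin N, Complex.normSq ((curl 1 Y p) a b') :=
  sum_normSq_le_curl_normSq_of_pinned hd Q hQ0 hQs Y hk hQY fun x hx =>
    hpin x fun y hxy => hx ⟨y, hxy.symm⟩

/-- ★ **THE T³ INSTANCE** (run `K` of a T³ family, comparison height `n`, `k = K − n`, `d = 3`): for `Q^{(K−n)}Y = 0` and `∂^*Y` pinned at the `(K−n)`-centres,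
`Σ_b ‖Y(b)‖²_F ≤ (4200·N²·L⁴/(√L − 1)² + 97/8)·L^{2(K−n)}·Σ_p ‖(∂Y)(p)‖²_F`, uniformly in `m`, `n`, `K`.
[cite: Balaban1984PropagatorsI, Prop. 1.1 (1.90) p.33; Balaban1985Variational, Prop. 7 p.299] -/
theorem sum_normSq_le_curl_normSq_of_pinned_T3 (F : T3ContinuumYM3Torus.T3Family) (K n : ℕ) [NeZero N]
    (Q : (i : ℕ) → (PBond (F.P K) 0 → Matrix (Fin N) (Fin N) ℂ) → PBond (F.P K) i → Matrix (Fin N) (Fin N) ℂ)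
    (hQ0 : ∀ Y, Q 0 Y = Y)
    (hQs : ∀ (i : ℕ) (Y : PBond (F.P K) 0 → Matrix (Fin N) (Fin N) ℂ) (c : PBond (F.P K) (i + 1)), Q (i + 1) Y c = linAvg (Q i Y) c)
    (Y : PBond (F.P K) 0 → Matrix (Fin N) (Fin N) ℂ) (hQY : ∀ c : PBond (F.P K) (K - n), Q (K - n) Y c = 0)
    (hpin : ∀ x : Site (F.P K) 0, x ∉ Set.range (embIter (K - n)) → diverg 1 Y x = 0) :
    ∑ b : PBond (F.P K) 0, ∑ a : Fin N, ∑ b' : Fin N, Complex.normSq ((Y b) a b')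
      ≤ (4200 * (N : ℝ) ^ 2 * (F.L : ℝ) ^ 4 / (Real.sqrt F.L - 1) ^ 2 + 97 / 8) * ((F.L : ℝ) ^ (K - n)) ^ 2
          * ∑ p : Plaq (F.P K) 0, ∑ a : Fin N, ∑ b' : Fin N, Complex.normSq ((curl 1 Y p) a b') := by
  have hk : K - n ≤ (F.P K).m + (F.P K).K := by
    have := F.hm
    show K - n ≤ F.m + K
    omega
  exact sum_normSq_le_curl_normSq_of_pinned (P := F.P K) (T3ContinuumYM3Torus.T3Family.P_d F K) Q hQ0 hQs Y hk hQY hpin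

end Summit.QuantumFields.YangMills.Theorems.Prop7PinnedFlatCoercivity

end
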